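import Summits.QuantumFields.YangMills.Theorems.BalabanUVNodesN11Thm2AlongSupplyChainUpperHalf

/-!
# DAG node N11 — THE CHAIN's (2.49) EDGE ALONG THE β-WINDOW: (2.46)'s coupling inputs («for κ₀ ≥ 7 and g sufficiently small»), the signs `g_j ≥ 0`, `β_j ≥ 0` DISCHARGED from the
# window letters of the run of record (g0 FILE 2's `sum246_inputs_at_record₁₃_of_window`, `beta_nonneg_at_record₁₃_of_lower`), leaving the `R₁`-dependent smallness
# `R₁·γ^{κ₀−6} ≤ 1` — print's «R₁ can be taken as equal to 1 for g_j sufficiently small» — as the one displayed coupling condition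

Cell `pub-ymgap`, YM-PLAN Track A (HUMAN RULING D-0062 ∕ D-0149), seat `pub-ymgap-dag-n11-w2` (g2), route `BalabanUVNodes`, key item K1⁷ `StabilityBAtRecordR13SepCoPH` =
stmt-QuantumFields-20542 (helper, count-neutral).  [III] = [Balaban1988Convergent], [I] = [Balaban1987RG1].  Over g2's `…Thm2AlongSupplyChain` ∕ `…UpperHalf` (the chain edges
`ineq249_action23_chainWitness_of_obligations` ∕ `action23_chainWitness_le_of_obligations`) and g0 FILE 2 `…Thm2Ineq249AtRecord13CoPHWindow` (p585614).

WHY THIS FILE.  g2's chain edges display, per datum, (2.46)'s coupling inputs `Σ_{j≤n} g_j^{κ₀} ≤ g_n^{κ₀−6}` and `R₁ g_n^{κ₀−6} ≤ 1` and, globally, `g_j ≥ 0` (`j ≤ K`) — and the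
upper-half edge also `β_j ≥ 0`.  At the run of record these are CONSEQUENCES of the β-WINDOW LETTERS the K1⁷ crux speaks (`stub_betaWindow13PWS`'s currency): the window
`(genFlow (betaOfRecord₁₃ …) p.g0).InInterval γ K′` (`0 < g_j ≤ γ`, `j ≤ K′`; `Iff.rfl`-equal to the §2 setting's window, g0 FILE 2), the asymptotic-freedom lower bound
`b′ ≤ g_j^{−2} − g_{j+1}^{−2}` (`j < K′`, `b′ > 0`), `γ⁴ ≤ b′`, `γ ≤ ½`, `p.K ≤ K′` — g0 FILE 2's `sum246_inputs_at_record₁₃_of_window` (needs `R₁·γ^{κ₀−6} ≤ 1`) and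
`beta_nonneg_at_record₁₃_of_lower`.  THIS FILE restates the chain edges with those letters, the `R₁`-dependent `R₁·γ^{κ₀−6} ≤ 1` staying INSIDE the existential (it depends on
Theorem 2's `R₁`, exactly print's «(In fact the constant R₁ can be taken as equal to 1 for g_j sufficiently small.)»).

WHAT THIS FILE PROVES (0 `sorry`, 0 `def`, standard axioms; count-neutral; nothing of Bałaban's asserted).
`couplings_nonneg_of_window` (`0 ≤ g_j`, `j ≤ K`, from the window and `K ≤ K′`) · ★★ `ineq249_action23_chainWitness_of_obligations_of_window` (the chain's (2.49) edge:
`(hσ, hT)` + provisos + supply tokens at the chain witness + (2.41)(ii)-regular class + `0 < β < 1`, `κ₀ ≥ 7`, `H033` + WINDOW LETTERS ⇒ `∃ E₁ R₁ ≥ 0`, ∀ k ≤ K, s, U ∈ 𝒰 k s,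
volumes, `R₁·γ^{κ₀−6} ≤ 1` → vacuum → (2.49)) · ★★ `action23_chainWitness_le_of_obligations_of_window` (the constant-coupling upper half likewise, `β_j ≥ 0` discharged,
`φ_j ≤ 1` displayed).

HONEST FRAMING.  Kernel composition; the window letters (the DAG's unprinted `betaPositive` ∕ window leaf, T09.F), Theorem 2 (keyed), the obligations, row-type regularity and
the vacuum sentence are HYPOTHESES; nothing of Bałaban asserted; N11 NOT discharged; K1⁷ NOT closed; counts unmoved (typed 28∕28 · discharged 5∕27).  One finite four-torus
programme at fixed `ε = L^{−K}`; R4 closes only the conditional finite-𝕋⁴ rung `BalabanLadder.UV`; NOT ℝ⁴, NOT OS, NOT the Yang–Mills mass gap (Clay), which none of this proves.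
Sources: [III] (2.46) p.263 («for κ₀ ≥ 7 and g sufficiently small»), Thm 2 p.263, (2.49) p.264; [I] (0.20) p.256, (0.31) p.259.
-/

noncomputable section

open scoped BigOperators Matrix.Norms.L2Operator

namespace Summit.QuantumFields.YangMills.Theorems.BalabanUVNodesN11Thm2AlongSupplyChainWindow

open Literature.MathematicalPhysics.QuantumFieldTheory.Balaban1983to89 Step B14.Eq225Concrete B14.LocalCoupling B14Thm2 B12TreeDecay TreeLengthTorus Finset
open T4Continuum Node00 B15DeterminingSets
open FlowStepRuns (genFlow)
open B10Eq38TorusDomains (toFine)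
open BalabanUVNodesN11Sect3SupplyChainDefs (Sect3Supplier chainWitness)
open BalabanUVNodesN11Sect3SupplyChainObligationsDefs (SupplierObligations NoExpansionObligation)
open BalabanUVNodesN11Thm2Sect2DataOfRecordKeyedDefs (sect2DataOfRecord₁₃Keyed)
open BalabanUVNodesN11Thm2AlongSupplyChain (ineq249_action23_chainWitness_of_obligations)
open BalabanUVNodesN11Thm2AlongSupplyChainUpperHalf (action23_chainWitness_le_of_obligations)
open BalabanUVNodesN11Thm2Ineq249AtRecord13CoPHWindow (sum246_inputs_at_record₁₃_of_window beta_nonneg_at_record₁₃_of_lower)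

variable {F : T4Family} {N : ℕ} [NeZero N]
variable (θ : Stage13HParams F N) (p : B12.RunParams)

/-- **The couplings of record are non-negative up to `K` on the window** (`0 < g_j ≤ γ` for `j ≤ K′`, `K ≤ K′`). [cite: Balaban1987RG1, (0.31) p.259 (bookkeeping)] -/
theorem couplings_nonneg_of_window {γ : ℝ} {K' : ℕ} (hI : (genFlow (betaOfRecord₁₃ F N θ.toStage13Params) p.g0).InInterval γ K') (hK : p.K ≤ K') :
    ∀ j, j ≤ p.K → 0 ≤ gOfRecord₁₃ F N θ.toStage13Params p j :=
  fun j hj => (hI j (hj.trans hK)).1.le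

variable (𝒰 : (k : ℕ) → SeqOfRecord F θ.ν θ.τ9.M (gOfRecord₁₃ F N θ.toStage13Params p) p.K k → Set (GaugeField (F.P p.K) 0 (SU N)))

open Classical in
/-- **★★ THE CHAIN's (2.49) EDGE ALONG THE β-WINDOW**: `(hσ, hT)` + def-T's provisos + Theorem 2 keyed to the chain at a (2.41)(ii)-regular class + `0 < β < 1`, `1 < L`, `κ₀ ≥ 7`,
`H033` at the run's flow, `κ₀(4·2^d,2d) ≤ θ.s2.lf.κ` + the WINDOW LETTERS (`InInterval γ K′`, `b′ ≤ g_j^{−2} − g_{j+1}^{−2}`, `0 < b′`, `γ⁴ ≤ b′`, `γ ≤ ½`, `K ≤ K′`) ⇒ `∃ E₁ R₁ ≥ 0`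
such that for every `k ≤ K`, history `s`, `U ∈ 𝒰 k s`, volumes `Γ_n` dominating `|Γ_n(s)|` and `#ring_n(s)`, the ONE remaining coupling condition `R₁·γ^{κ₀−6} ≤ 1` and the vacuum
sentence give (2.49) for the chain's (2.23)-action (`O(1) = E₁(1−L^{−β})⁻¹ + 1 + 2·θ.s2.lf.B₀·K₀(4·2^d,2d) + E₂`). [cite: Balaban1988Convergent, (2.46) p.263, Thm 2 p.263, (2.49) p.264] -/
theorem ineq249_action23_chainWitness_of_obligations_of_window (σ : Sect3Supplier θ p) (hprov : θ.Provisos₁₃CoPH F N)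
    (hsel : θ.ppSel = ppSelLiveOfRecord F N θ.ν θ.τ9 (EOfRecord₁₃ F N θ.toStage13Params) (wOfRecord₉ F N θ.toStage9Params))
    (hθ : θ.Admissible F N) (hE₀ : 0 ≤ θ.s2.lf.E₀) (hB₀ : 0 ≤ θ.s2.lf.B₀) (hM : 1 ≤ θ.τ9.M)
    (hκ : kappa₀ (4 * 2 ^ (F.P p.K).d) (2 * (F.P p.K).d) ≤ θ.s2.lf.κ)
    (hσ : SupplierObligations θ p σ) (hT : NoExpansionObligation θ p σ)
    (H033 : Flow → ℕ → Prop) {L β : ℝ} {κ₀ : ℕ}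
    (hT2 : B14.Thm2Printed H033 (fun _ : PUnit => sect2DataOfRecord₁₃Keyed θ p (fun k s => (chainWitness θ p σ k).1 s) 𝒰) L β κ₀)
    (hβ1 : β < 1) (hβ0 : 0 < β) (hL : 1 < L) (hκ7 : 7 ≤ κ₀)
    (h033 : H033 (flowOfRun (gOfRecord₁₃ F N θ.toStage13Params p)) p.K)
    -- the window letters
    {γ b' : ℝ} {K' : ℕ} (hb' : 0 < b') (hγ4 : γ ^ 4 ≤ b') (hγ2 : γ ≤ 1 / 2)
    (hI : (genFlow (betaOfRecord₁₃ F N θ.toStage13Params) p.g0).InInterval γ K')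
    (hlb : ∀ j, j < K' → b' ≤ 1 / gOfRecord₁₃ F N θ.toStage13Params p j ^ 2 - 1 / gOfRecord₁₃ F N θ.toStage13Params p (j + 1) ^ 2) (hK : p.K ≤ K')
    (h𝒰 : ∀ k (s : SeqOfRecord F θ.ν θ.τ9.M (gOfRecord₁₃ F N θ.toStage13Params p) p.K k) (U : GaugeField (F.P p.K) 0 (SU N)), U ∈ 𝒰 k s →
      ∀ j, 1 ≤ j → j ≤ k → ∀ X, Sect2.admB (F.P p.K) θ.ν θ.τ9.M (gOfRecord₁₃ F N θ.toStage13Params p) s.Ω s.Λ j (Sect2.domSites (F.P p.K) θ.τ9.M j X) = true →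
        Sect2.ofBackgroundC (ιSU N) U ∈ Sect2.spaceMS (settingOfRecord₁₃ F N θ.toStage13Params p) (θ.rzAt p s) θ.τ9.M j (Sect2.domSites (F.P p.K) θ.τ9.M j X) s.Ω) :
    ∃ E₁ R₁ : ℝ, 0 ≤ E₁ ∧ 0 ≤ R₁ ∧
      ∀ k, k ≤ p.K → ∀ (s : SeqOfRecord F θ.ν θ.τ9.M (gOfRecord₁₃ F N θ.toStage13Params p) p.K k) (U : GaugeField (F.P p.K) 0 (SU N)), U ∈ 𝒰 k s →
      ∀ (a : Tk.SFluct (F.P p.K) (FluctV N)) (Ek EkLog EkRest : ℝ), Ek = EkLog + EkRest → ∀ (E₂ : ℝ) (Γ : ℕ → ℝ),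
      (∀ n, 1 ≤ n → n ≤ k → ((univ.filter fun y : Site (F.P p.K) n => toFine n y ∈ gammaRegion s.Ω k n).card : ℝ) ≤ Γ n) →
      (∀ n, 1 ≤ n → n ≤ k →
        ((univ.filter fun c : TPt (F.P p.K).d (Sect2.domCount (F.P p.K) θ.τ9.M n) =>
            (Sect2.domSites (F.P p.K) θ.τ9.M n (Sect2.cubeDom (F.P p.K) θ.τ9.M n c) ∩
                Sect2.enlT (F.P p.K) (Sect2.zSide (F.P p.K) θ.ν θ.τ9.M (gOfRecord₁₃ F N θ.toStage13Params p) n) 1 (s.Λ n)ᶜ).Nonempty ∧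
              ∃ c', (c' = c ∨ TAdj c' c) ∧ (Sect2.domSites (F.P p.K) θ.τ9.M n (Sect2.cubeDom (F.P p.K) θ.τ9.M n c') ∩ s.Ω n).Nonempty).card : ℝ) ≤ Γ n) →
      R₁ * γ ^ (κ₀ - 6) ≤ 1 →
      VacuumRestBound EkRest E₂ Γ k →
      Ineq249 ((sect2ActionDataOfRecord F N (FluctV N) p.K (settingOfRecord₁₃ F N θ.toStage13Params p) (θ.rzAt p s) s ((chainWitness θ p σ k).1 s) a Ek).action23 k U)
        (smearedWilson (invSq (flowOfRun (gOfRecord₁₃ F N θ.toStage13Params p)) (θ.Phih p k s.Ω s.Λ) k) U) (-EkLog)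
        (E₁ * (1 - L ^ (-β))⁻¹ + 1 + 2 * (θ.s2.lf.B₀ * K₀ (4 * 2 ^ (F.P p.K).d) (2 * (F.P p.K).d)) + E₂) Γ k := by
  obtain ⟨E₁, R₁, hE, hR, hall⟩ := ineq249_action23_chainWitness_of_obligations θ p σ 𝒰 hprov hsel hθ hE₀ hB₀ hM hκ hσ hT H033 hT2 hβ1 hβ0 hL hκ7 h033
    (couplings_nonneg_of_window θ p hI hK) h𝒰
  refine ⟨E₁, R₁, hE, hR, fun k hk s U hU a Ek EkLog EkRest hEk E₂ Γ hΓ hΓr hRγ hvac => ?_⟩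
  obtain ⟨hsum, hsmall⟩ := sum246_inputs_at_record₁₃_of_window θ p hκ7 hb' hγ4 hγ2 hR hRγ hI hlb (hk.trans hK)
  exact hall k hk s U hU a Ek EkLog EkRest hEk E₂ Γ hΓ hΓr hsum hsmall hvac

open Classical in
/-- **★★ Its constant-coupling UPPER half along the β-window** (dag-n13-w3's `h249up` currency): the same letters also discharge `β_j ≥ 0` (g0 FILE 2's
`beta_nonneg_at_record₁₃_of_lower`); displayed per datum: `φ_j ≤ 1`, volumes, `R₁·γ^{κ₀−6} ≤ 1`, vacuum. [cite: Balaban1988Convergent, (2.46) p.263, (2.49)–(2.50) p.264] -/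
theorem action23_chainWitness_le_of_obligations_of_window (σ : Sect3Supplier θ p) (hprov : θ.Provisos₁₃CoPH F N)
    (hsel : θ.ppSel = ppSelLiveOfRecord F N θ.ν θ.τ9 (EOfRecord₁₃ F N θ.toStage13Params) (wOfRecord₉ F N θ.toStage9Params))
    (hθ : θ.Admissible F N) (hE₀ : 0 ≤ θ.s2.lf.E₀) (hB₀ : 0 ≤ θ.s2.lf.B₀) (hM : 1 ≤ θ.τ9.M)
    (hκ : kappa₀ (4 * 2 ^ (F.P p.K).d) (2 * (F.P p.K).d) ≤ θ.s2.lf.κ)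
    (hσ : SupplierObligations θ p σ) (hT : NoExpansionObligation θ p σ)
    (H033 : Flow → ℕ → Prop) {L β : ℝ} {κ₀ : ℕ}
    (hT2 : B14.Thm2Printed H033 (fun _ : PUnit => sect2DataOfRecord₁₃Keyed θ p (fun k s => (chainWitness θ p σ k).1 s) 𝒰) L β κ₀)
    (hβ1 : β < 1) (hβ0 : 0 < β) (hL : 1 < L) (hκ7 : 7 ≤ κ₀)
    (h033 : H033 (flowOfRun (gOfRecord₁₃ F N θ.toStage13Params p)) p.K)
    {γ b' : ℝ} {K' : ℕ} (hb' : 0 < b') (hγ4 : γ ^ 4 ≤ b') (hγ2 : γ ≤ 1 / 2)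
    (hI : (genFlow (betaOfRecord₁₃ F N θ.toStage13Params) p.g0).InInterval γ K')
    (hlb : ∀ j, j < K' → b' ≤ 1 / gOfRecord₁₃ F N θ.toStage13Params p j ^ 2 - 1 / gOfRecord₁₃ F N θ.toStage13Params p (j + 1) ^ 2) (hK : p.K ≤ K')
    (h𝒰 : ∀ k (s : SeqOfRecord F θ.ν θ.τ9.M (gOfRecord₁₃ F N θ.toStage13Params p) p.K k) (U : GaugeField (F.P p.K) 0 (SU N)), U ∈ 𝒰 k s →
      ∀ j, 1 ≤ j → j ≤ k → ∀ X, Sect2.admB (F.P p.K) θ.ν θ.τ9.M (gOfRecord₁₃ F N θ.toStage13Params p) s.Ω s.Λ j (Sect2.domSites (F.P p.K) θ.τ9.M j X) = true →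
        Sect2.ofBackgroundC (ιSU N) U ∈ Sect2.spaceMS (settingOfRecord₁₃ F N θ.toStage13Params p) (θ.rzAt p s) θ.τ9.M j (Sect2.domSites (F.P p.K) θ.τ9.M j X) s.Ω) :
    ∃ E₁ R₁ : ℝ, 0 ≤ E₁ ∧ 0 ≤ R₁ ∧
      ∀ k, k ≤ p.K → ∀ (s : SeqOfRecord F θ.ν θ.τ9.M (gOfRecord₁₃ F N θ.toStage13Params p) p.K k) (U : GaugeField (F.P p.K) 0 (SU N)), U ∈ 𝒰 k s →
      (∀ j, 1 ≤ j → j ≤ k → ∀ x, θ.Phih p k s.Ω s.Λ j x ≤ 1) →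
      ∀ (a : Tk.SFluct (F.P p.K) (FluctV N)) (Ek EkLog EkRest : ℝ), Ek = EkLog + EkRest → ∀ (E₂ : ℝ) (Γ : ℕ → ℝ),
      (∀ n, 1 ≤ n → n ≤ k → ((univ.filter fun y : Site (F.P p.K) n => toFine n y ∈ gammaRegion s.Ω k n).card : ℝ) ≤ Γ n) →
      (∀ n, 1 ≤ n → n ≤ k →
        ((univ.filter fun c : TPt (F.P p.K).d (Sect2.domCount (F.P p.K) θ.τ9.M n) =>
            (Sect2.domSites (F.P p.K) θ.τ9.M n (Sect2.cubeDom (F.P p.K) θ.τ9.M n c) ∩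
                Sect2.enlT (F.P p.K) (Sect2.zSide (F.P p.K) θ.ν θ.τ9.M (gOfRecord₁₃ F N θ.toStage13Params p) n) 1 (s.Λ n)ᶜ).Nonempty ∧
              ∃ c', (c' = c ∨ TAdj c' c) ∧ (Sect2.domSites (F.P p.K) θ.τ9.M n (Sect2.cubeDom (F.P p.K) θ.τ9.M n c') ∩ s.Ω n).Nonempty).card : ℝ) ≤ Γ n) →
      R₁ * γ ^ (κ₀ - 6) ≤ 1 →
      VacuumRestBound EkRest E₂ Γ k →
      (sect2ActionDataOfRecord F N (FluctV N) p.K (settingOfRecord₁₃ F N θ.toStage13Params p) (θ.rzAt p s) s ((chainWitness θ p σ k).1 s) a Ek).action23 k U ≤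
        -(1 / (gOfRecord₁₃ F N θ.toStage13Params p k) ^ 2 * wilsonAction4 U) - EkLog +
          (E₁ * (1 - L ^ (-β))⁻¹ + 1 + 2 * (θ.s2.lf.B₀ * K₀ (4 * 2 ^ (F.P p.K).d) (2 * (F.P p.K).d)) + E₂) * ∑ n ∈ Icc 1 k, Γ n := by
  obtain ⟨E₁, R₁, hE, hR, hall⟩ := action23_chainWitness_le_of_obligations θ p 𝒰 σ hprov hsel hθ hE₀ hB₀ hM hκ hσ hT H033 hT2 hβ1 hβ0 hL hκ7 h033
    (couplings_nonneg_of_window θ p hI hK) h𝒰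
  refine ⟨E₁, R₁, hE, hR, fun k hk s U hU hφ a Ek EkLog EkRest hEk E₂ Γ hΓ hΓr hRγ hvac => ?_⟩
  obtain ⟨hsum, hsmall⟩ := sum246_inputs_at_record₁₃_of_window θ p hκ7 hb' hγ4 hγ2 hR hRγ hI hlb (hk.trans hK)
  exact hall k hk s U hU (beta_nonneg_at_record₁₃_of_lower θ p hb' hlb (hk.trans hK)) hφ a Ek EkLog EkRest hEk E₂ Γ hΓ hΓr hsum hsmall hvac

end Summit.QuantumFields.YangMills.Theorems.BalabanUVNodesN11Thm2AlongSupplyChainWindow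

end
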